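import Literature.MathematicalPhysics.QuantumFieldTheory.Dimock2011to13.Phi43Stability
import Literature.MathematicalPhysics.QuantumFieldTheory.Balaban1983to89.TreeLengthTorus
import Literature.MathematicalPhysics.QuantumFieldTheory.Balaban1983to89.TreeLengthTorusGeometry

/-!
# Dimock, *The renormalization group according to Balaban* III: Theorem 2 (the convergent polymer
representation of `Z_{M,N}`) typed over the cell's formalised tree length, and the END IMPLICATION
Theorem 2 ⇒ Corollary 1 (stability) PROVED with its printed arithmetic

**Citation header (reproduction of PUBLISHED work; template of the Balaban lattice Yang–Mills cell).**
J. Dimock, *The renormalization group according to Balaban. III. Convergence*, Ann. Henri Poincaré **15**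
(2014) 2133–2175 (= arXiv:1304.0705v1) [Dimock2013BalabanIII], §3.6 "the stability bound": Theorem 2
(TeX `\label{major1}`, eqs. (soso), (such)) and Corollary 1 (TeX `\label{major2}`) with its four-line proof;
*I. Small fields*, Rev. Math. Phys. **25** (2013) 1330010 (= arXiv:1108.1335v2) [Dimock2013], §3.1: the
`M`-polymers (TeX L1163–1170), the tree length `d_M` (L1327–1329), `|X|_M` (L1341–1342) and the summation
bound (summing0) (L1350–1355).  TeX line numbers refer to the arXiv sources held by the cell
(`inputs/files/dimock/src/1304.0705/1304.0705.tex`, `…/1108.1335/*.tex`).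

**What is reproduced here.**  The sibling module `…Dimock2011to13.Phi43Stability` types the MODEL and the END
STATEMENT (III Corollary 1, `Dimock2014_phi43StabilityBound`) and says in its header: *"III Theorem 2 itself
(the convergent polymer representation `Z = Z(0) exp Σ_X H(X)`, `|H(X)| ≤ O(1) λ^{β/2} e^{-κ₀ d_M(X)}`) is NOT
typed here (it needs the polymer/tree-length apparatus of I §3)"*.  That apparatus now exists in the tree on the
periodic carrier: `…Balaban1983to89.TreeLengthTorus` (cubes of a torus indexed by `(ℤ/n)^d`, wall adjacency
`TAdj`, face-connected families `TFaceConnected`, the linear size `torusTreeLen` = the length of a shortest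
connected polygonal graph in the union of the cubes meeting all of them, and — hypothesis-free — the summation
bound `sum_exp_torusTreeLen_le`).  Dimock's polymers and tree length are THE SAME OBJECTS as Bałaban's
localization domains and `d_j` ([Dimock2013] L1165–1168: *"An M-polymer X is a connected unions of such cubes.
Here connected means that for any two cubes □, □′ in X there is a sequence □ = □₀, □₁, □₂, …, □_m = □′ such
that □_j ⊂ X and □_j and □_{j+1} have a (d−1) = 2 dimensional face in common."*; L1327–1329: *"M d_M(X) = the
length of the shortest tree in X joining the M-cubes in X. Here the tree is in the continuum torus
𝕋_{𝖬+𝖭−k} = (ℝ/(L^{𝖬+𝖭−k})ℤ)³"* — compare [Balaban1987RG1] p. 257 quoted in `…TreeLengthTorus`), so this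
module types, for `d = 3`:
* Part 1 — the `M`-polymers of the final torus `𝕋^{−𝖭}_𝖬` as the non-empty torus-face-connected families of
  cubes (`polymers n`, `n` cubes per direction), the polymers through a given cube (`polymersAt n □`), and THREE
  PRINTED STATEMENTS AS HYPOTHESIS SHAPES (nothing asserted): (summing0) `Summing0 n κ₀ K₀`; the activity bound
  (such) `ActivityBound n H C λ β κ₀`; the representation (soso) `PolymerRepresentation L 𝖬 𝖭 n λ ε₀ μ₀ H`
  (an identity for the relative partition function of `…Phi43Stability`).
* Part 2 — PROVED: (summing0) HOLDS for the formalised tree length, for every `κ₀ ≥ κ₀(32, 6)` with the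
  constant `K₀(32, 6)` of `…Balaban1983to89.B12TreeDecay` (Dimock's *"constants κ₀ ≥ 1, K₀ depending only on
  the dimension"*, here `d = 3`: `c₀ = 4·2³ = 32`, `Δ = 2·3 = 6`) — `summing0_of_kappa₀_le`, a re-packaging of
  unit pv22's `TreeLengthTorus.sum_exp_torusTreeLen_le`.
* Part 3 — PROVED, the arithmetic of the proof of Corollary 1, verbatim: *"|Σ_{X ⊂ 𝕋^{−𝖭}_𝖬} ℋ(X)| ≤ 𝒪(1)
  λ^{β/2} |𝕋^{−𝖭}_𝖬|_M = 𝒪(1) M^{−3} λ^{β/2} Vol(𝕋_𝖬) ≤ λ^{β/2} Vol(𝕋_𝖬)"*: `sum_polymers_le_sum_polymersAt`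
  (a sum over polymers is at most the sum over cubes of the sums over polymers through the cube),
  `abs_sum_activity_le` (`|Σ_X H(X)| ≤ C·λ^{β/2}·K₀·n³`, `n³ = |𝕋^{−𝖭}_𝖬|_M` by `TreeLengthTorus.card_tpt`).
* Part 4 — PROVED, THE END IMPLICATION: `stability_of_polymerRepresentation` — (soso) ∧ (such) ∧ (summing0)
  ⟹ `exp(−B) ≤ Z_{𝖬,𝖭}/Z_{𝖬,𝖭}(0) ≤ exp(B)` with `B = C K₀ λ^{β/2} n³`; `stability_eta_half` — with
  `M³·n³ = Vol(𝕋_𝖬) = L^{3𝖬}` (`cubeCount_mul_eq`: `M = L^m`, `n = L^{𝖬−m}`, `m ≤ 𝖬`) and the absorbed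
  smallness `C·K₀ ≤ M³` (the printed last "≤", *"This follows with η = β/2"*), the printed two-sided bound
  `exp(−λ^{β/2} Vol(𝕋_𝖬)) ≤ Z_{𝖬,𝖭}/Z_{𝖬,𝖭}(0) ≤ exp(λ^{β/2} Vol(𝕋_𝖬))`, i.e. EXACTLY the inner inequality
  of `Phi43Stability.Dimock2014_phi43StabilityBound` at `η = β/2`; `stability_eta_half_kappa₀` — the same
  with (summing0) DISCHARGED (hypotheses left: the representation, the activity bound at some
  `κ₀ ≥ κ₀(32,6)`, `C K₀(32,6) ≤ M³`).

* Part 5 (v2, append-only after the v1 declarations) — PROVED, THE EXPONENTIATION STEP OF THE PROOF OF THEOREM 2: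
  from the un-exponentiated representation (stingray) (*"𝖹_{𝖬,𝖭} = 𝖹_{𝖬,𝖭}(0) Σ_{{U_ℓ}} Π_ℓ 𝒦(U_ℓ) where the sum is
  over disjoint connected {U_ℓ}"*, typed as the hard-core polymer partition function of the torus gas with Dimock's
  incompatibility `Overlap` = a common cube, hypothesis shape `ComponentRepresentation`) and Lemma 17 (swat) (hypothesis
  shape `ComponentActivityBound`), the tree-proved Kotecký–Preiss theorem (in place of *"a standard theorem (Appendix
  B, part I)"*) gives (soso) ∧ (such) for ℋ := `clusterH 𝒦` (`polymerRepresentation_of_components`) and, with Part 4,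
  Corollary 1 (`stability_of_components`); see the `/-! # v2 … -/` block below for loci, constants and divergences.
* Part 6 (v2.1, append-only) — PROVED: (toot) ⇒ Lemma 17 (swat) (*"This is sufficient since |U|_M ≤ 𝒪(1)(d_M(U) + 𝒪(1))
  and λ is small"*) by unit pv22's torus volume bound `card_le_torusTreeLen` (`componentActivityBound_of_toot`), and
  (stingray) ∧ (toot) ⇒ Corollary 1 (`stability_of_toot`): §3.6 from (toot) on is kernel over the cell's polymer model.

**What is NOT claimed.**  (i) Theorem 2 is NOT proved or asserted: `PolymerRepresentation` / `ActivityBound`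
are hypothesis shapes; the typed Corollary 1 (`Dimock2014_phi43StabilityBound`) stays un-asserted.  (ii) The
quantifier structure of Theorem 2 (*"Let μ̄ = 1 and let λ be sufficiently small. Then there is a choice of
counterterms ε^𝖭₀, μ^𝖭₀ such that …"*, under Theorem 1's *"Let L be sufficiently large, let M be sufficiently
large (depending on L), and let λ_k be sufficiently small (depending on L, M)"*) is not re-typed: the
implication is proved INSTANCE-WISE (fixed `L, 𝖬, 𝖭, m, λ, ε₀, μ₀, H`), which is how the printed proof of
Corollary 1 uses it; by the printed convention (III, TeX L387: *"Throughout the paper 𝒪(1) stands for a generic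
constant independent of all parameters, C stands for a generic constant possibly depending on L"*) the printed
absorption `𝒪(1)M^{−3} ≤ 1` is a condition on `M` alone — displayed here as the explicit hypothesis `C·K₀ ≤ M³`
(the Lean binder `C` names the printed 𝒪(1); nothing is hidden).  (iii) The torus 𝕋^{−𝖭}_𝖬 has side `L^𝖬` and the
`M = L^m`-cubes partition it only
when `m ≤ 𝖬` (`n = L^{𝖬−m}` cubes per direction); for `𝖬 < m` nothing is claimed (Corollary 1 as typed in
`…Phi43Stability` quantifies over all `𝖬`; the implication proved here covers `𝖬 ≥ m`).  (iv) `torusTreeLen`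
carries the conventions D-pv22.1 / D-pv22g2.1 of the cell (sup metric — [Dimock2013BalabanII] App. E *"(We use
the metric |x − y| = sup_μ |x_μ − y_μ|)"*; connected polygonal graphs in place of trees; geometry in the
universal cover); Dimock's `κ₀, K₀` "depending only on the dimension" are instantiated by the cell's
`kappa₀ (4·2^d) (2d)`, `K₀ (4·2^d) (2d)` at `d = 3` — any constants for which (summing0) holds serve the printed
proof, and these do.  (v) No quantity of the Bałaban series is touched; Dimock's papers are published and
refereed and are the cell's TEMPLATE, not manuscripts under audit.  Value = kernel-checked bookkeeping of the
template's last implication over the cell's own tree-length model, NOT summit progress (YM₄ on T⁴ / infinite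
volume / mass gap are elsewhere and out of scope).

Cell records: TEMPLATE.md §4.3 / §13 (D3 ↔ B10 §D, B14 Cor. 3, B16 §1), §15 (the polymer toolkit);
FINAL-STATEMENT.md (the sense of "ultraviolet stability"); unit `b2b-balaban-template` gen 13, journal claim
D3-THM2-COR1-KERNEL.  NEW leaf; imports `…Dimock2011to13.Phi43Stability` (this lineage, p175764) and
`…Balaban1983to89.TreeLengthTorus` (unit pv22, p177631); modifies nothing.  v1 = p182573 (cross-read: cell GAPS.md
C-pv14-47, ok, its optional DOCFIX D1 — Dimock's 𝒪(1)-convention — folded in (ii) below); v2 (journal claim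
D3-STINGRAY-EXP-KERNEL): + import `…Balaban1983to89.TreeLengthTorusGeometry` (unit pv22, p177824) and Part 5,
append-only (v1 declarations byte-identical); v2.1: + Part 6 ((toot) ⇒ Lemma 17 (swat) by the torus volume bound;
`componentActivityBound_of_toot`, `stability_of_toot`), append-only (v2 declarations byte-identical); v2.2
(docstring-only, folds the Part 6 cross-read, cell GAPS.md C-pv01-50): (swat) is LEMMA 17 of arXiv:1304.0705v1 (its
`\begin{lem}` at TeX L2393 is the 17th under the global `\newtheorem{lem}{Lemma}` counter; the journal/arXiv PDF
prints "Lemma 17." above (swat); Lemma 15 is `\label{sushi}`, TeX L2254) — the twelve occurrences of "Lemma 15"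
of v1–v2.1, all naming (swat), corrected to "Lemma 17"; declarations byte-identical.
-/

noncomputable section

open Real Finset
open Literature.MathematicalPhysics.QuantumFieldTheory.Balaban1983to89.TreeLengthTorus
  (TPt TFaceConnected torusTreeLen torusTreeLen_nonneg sum_exp_torusTreeLen_le card_tpt)
open Literature.MathematicalPhysics.QuantumFieldTheory.Balaban1983to89.B12TreeDecay (kappa₀ K₀ K₀_pos)

namespace Literature.MathematicalPhysics.QuantumFieldTheory.Dimock2011to13

variable {n : ℕ}

/-! ## Part 1. `M`-polymers of the final torus and the printed statements as hypothesis shapes -/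

/-- The `M`-POLYMERS of the torus with `n` `M`-cubes per direction (`d = 3`): non-empty families of cubes, connected
through common two-dimensional faces — [Dimock2013] §3.1, verbatim: *"An M-polymer X is a connected unions of such
cubes. Here connected means that for any two cubes □, □′ in X there is a sequence □ = □₀, □₁, □₂, …, □_m = □′ such
that □_j ⊂ X and □_j and □_{j+1} have a (d−1) = 2 dimensional face in common."* and *"𝒟_k = all M-polymers X in
𝕋^{−k}_{𝖬+𝖭−k}"*; the cubes and their wall adjacency on the periodic carrier are `TreeLengthTorus.TPt`/`TAdj`.
[cite: Dimock2013, §3.1 (arXiv:1108.1335v2 TeX L1163–1170)] -/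
def polymers (n : ℕ) [NeZero n] : Finset (Finset (TPt 3 n)) := by
  classical exact univ.filter fun X => X.Nonempty ∧ TFaceConnected X

/-- Membership in `polymers n`. [cite: Dimock2013, §3.1 (arXiv:1108.1335v2 TeX L1163–1170)] -/
theorem mem_polymers [NeZero n] {X : Finset (TPt 3 n)} : X ∈ polymers n ↔ X.Nonempty ∧ TFaceConnected X := by
  classical
  unfold polymers
  simp

/-- The `M`-polymers THROUGH a given cube `□` (the index set of (summing0): *"for any M-cube □, Σ_{X ⊃ □} …"*).
[cite: Dimock2013, §3.1 eq. (summing0) (arXiv:1108.1335v2 TeX L1350–1355)] -/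
def polymersAt (n : ℕ) [NeZero n] (c : TPt 3 n) : Finset (Finset (TPt 3 n)) := by
  classical exact univ.filter fun X => c ∈ X ∧ TFaceConnected X

/-- Membership in `polymersAt n □`. [cite: Dimock2013, §3.1 eq. (summing0) (arXiv:1108.1335v2 TeX L1350–1355)] -/
theorem mem_polymersAt [NeZero n] {c : TPt 3 n} {X : Finset (TPt 3 n)} :
    X ∈ polymersAt n c ↔ c ∈ X ∧ TFaceConnected X := by
  classical
  unfold polymersAt
  simp

/-- A polymer through `□` is a polymer. [folklore] -/
theorem mem_polymers_of_mem_polymersAt [NeZero n] {c : TPt 3 n} {X : Finset (TPt 3 n)}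
    (h : X ∈ polymersAt n c) : X ∈ polymers n := by
  rw [mem_polymersAt] at h
  exact mem_polymers.2 ⟨⟨c, h.1⟩, h.2⟩

/-- **(summing0) as a hypothesis shape** — [Dimock2013] §3.1, verbatim: *"there are constants κ₀ ≥ 1, K₀ depending
only on the dimension, so that for any M-cube □:  Σ_{X ⊃ □} e^{−κ₀ d_M(X)} ≤ K₀"* (proved in [Dimock2013] App. A
Lemma 25 (basic2); PROVED below for the formalised tree length, `summing0_of_kappa₀_le`). [cite: Dimock2013, §3.1 eq. (summing0) (arXiv:1108.1335v2 TeX L1350–1355)] -/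
def Summing0 (n : ℕ) [NeZero n] (κ₀ K : ℝ) : Prop :=
  ∀ c : TPt 3 n, ∑ X ∈ polymersAt n c, exp (-κ₀ * torusTreeLen X) ≤ K

/-- **(such) as a hypothesis shape** — [Dimock2013BalabanIII] Theorem 2, verbatim: *"|ℋ(X)| ≤ 𝒪(1) λ^{β/2}
e^{−κ₀ d_M(X)}"* for every connected union `X` of `M` cubes, with the constant `𝒪(1)` displayed as `C`.
[cite: Dimock2013BalabanIII, Theorem 2 eq. (such) (arXiv:1304.0705v1 TeX L2460–2462)] -/
def ActivityBound (n : ℕ) [NeZero n] (H : Finset (TPt 3 n) → ℝ) (C lam β κ₀ : ℝ) : Prop :=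
  ∀ X ∈ polymers n, |H X| ≤ C * lam ^ (β / 2) * exp (-κ₀ * torusTreeLen X)

/-- **(soso) as a hypothesis shape** — [Dimock2013BalabanIII] Theorem 2, verbatim: *"Let μ̄ = 1 and let λ be
sufficiently small. Then there is a choice of counterterms ε^𝖭₀, μ^𝖭₀ such that  𝖹_{𝖬,𝖭} = 𝖹_{𝖬,𝖭}(0) exp(Σ_X
ℋ(X))  where the sum is over connected unions of M cubes X ⊂ 𝕋^{−𝖭}_𝖬"* — typed at fixed `L, 𝖬, 𝖭`, `μ̄ = 1`,
coupling `λ`, counterterms `ε₀, μ₀`, with `n` `M`-cubes per direction, as an identity for the relative partition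
function of `…Phi43Stability` (both partition functions are positive reals there, `partitionFunction_pos`,
`freePartitionFunction_pos`).  NOT asserted. [cite: Dimock2013BalabanIII, Theorem 2 eq. (soso) (arXiv:1304.0705v1 TeX L2452–2459)] -/
def PolymerRepresentation (L Mv N n : ℕ) [NeZero L] [NeZero n] (lam ε₀ μ₀ : ℝ)
    (H : Finset (TPt 3 n) → ℝ) : Prop :=
  relativePartitionFunction L Mv N 1 lam ε₀ μ₀ = exp (∑ X ∈ polymers n, H X)

/-! ## Part 2. PROVED: (summing0) holds for the formalised tree length, constants depending on `d = 3` only -/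

/-- **(summing0) DISCHARGED**: for every `κ₀ ≥ κ₀(32, 6)` and every cube `□` of the torus, `Σ_{X ∋ □} e^{−κ₀ d(X)}
≤ K₀(32, 6)` — unit pv22's `TreeLengthTorus.sum_exp_torusTreeLen_le` at `d = 3` (`4·2³ = 32`, `2·3 = 6`) plus the
monotonicity `e^{−κ₀ d} ≤ e^{−κ₀(32,6) d}` (`d ≥ 0`, `torusTreeLen_nonneg`). [cite: Dimock2013, §3.1 eq. (summing0) and App. A Lemma 25 (basic2) (arXiv:1108.1335v2 TeX L1350–1355, L3080–3136)] -/
theorem summing0_of_kappa₀_le (n : ℕ) [NeZero n] {κ₀ : ℝ} (hκ : kappa₀ 32 6 ≤ κ₀) :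
    Summing0 n κ₀ (K₀ 32 6) := by
  classical
  intro c
  have hκ' : kappa₀ (4 * 2 ^ 3) (2 * 3) ≤ κ₀ := by
    have e1 : ((4 : ℝ) * 2 ^ 3) = 32 := by norm_num
    rw [e1]
    exact hκ
  have h := sum_exp_torusTreeLen_le 3 n c (κ := κ₀) hκ'
  have e1 : ((4 : ℝ) * 2 ^ 3) = 32 := by norm_num
  have e2 : (2 * 3 : ℕ) = 6 := by norm_num
  rw [e1, e2] at h
  have heq : polymersAt n c = univ.filter (fun X : Finset (TPt 3 n) => c ∈ X ∧ TFaceConnected X) := by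
    ext X
    rw [mem_polymersAt, mem_filter]
    simp
  rw [heq]
  exact h

/-! ## Part 3. PROVED: the polymer sum is `𝒪(1) λ^{β/2} |𝕋^{−𝖭}_𝖬|_M` -/

/-- A sum of non-negative terms over all polymers is at most the sum over cubes `□` of the sums over the polymers
through `□` (every polymer contains a cube) — the first "≤" of the proof of Corollary 1 (*"|Σ_X ℋ(X)| ≤ 𝒪(1)
λ^{β/2} |𝕋^{−𝖭}_𝖬|_M"* via (summing0) cube by cube). [cite: Dimock2013BalabanIII, proof of Corollary 1 (arXiv:1304.0705v1 TeX L2500–2505)] -/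
theorem sum_polymers_le_sum_polymersAt [NeZero n] (a : Finset (TPt 3 n) → ℝ) (ha : ∀ X, 0 ≤ a X) :
    ∑ X ∈ polymers n, a X ≤ ∑ c : TPt 3 n, ∑ X ∈ polymersAt n c, a X := by
  classical
  -- rewrite both sides as sums over all families with indicators
  have hR : ∑ c : TPt 3 n, ∑ X ∈ polymersAt n c, a X
      = ∑ X : Finset (TPt 3 n), ∑ c : TPt 3 n, (if c ∈ X ∧ TFaceConnected X then a X else 0) := by
    rw [sum_comm]
    refine sum_congr rfl fun c _ => ?_
    unfold polymersAt
    rw [sum_filter]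
  have hL : ∑ X ∈ polymers n, a X
      = ∑ X : Finset (TPt 3 n), (if X.Nonempty ∧ TFaceConnected X then a X else 0) := by
    unfold polymers
    rw [sum_filter]
  rw [hR, hL]
  refine sum_le_sum fun X _ => ?_
  by_cases hX : X.Nonempty ∧ TFaceConnected X
  · rw [if_pos hX]
    obtain ⟨⟨c₀, hc₀⟩, hconn⟩ := hX
    have key : (if c₀ ∈ X ∧ TFaceConnected X then a X else 0)
        ≤ ∑ c : TPt 3 n, (if c ∈ X ∧ TFaceConnected X then a X else 0) := by
      refine single_le_sum (f := fun c => if c ∈ X ∧ TFaceConnected X then a X else 0) ?_ (mem_univ c₀)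
      intro c _
      split_ifs
      · exact ha X
      · exact le_rfl
    rw [if_pos ⟨hc₀, hconn⟩] at key
    exact key
  · rw [if_neg hX]
    refine sum_nonneg fun c _ => ?_
    split_ifs
    · exact ha X
    · exact le_rfl

/-- **The polymer sum is small and extensive**: (such) and (summing0) give `|Σ_X ℋ(X)| ≤ C·λ^{β/2}·K₀·n³`, where
`n³ = |𝕋^{−𝖭}_𝖬|_M` is the number of `M`-cubes — the display *"|Σ_X ℋ(X)| ≤ 𝒪(1) λ^{β/2} |𝕋^{−𝖭}_𝖬|_M"* with its
𝒪(1) = `C·K₀` made explicit. [cite: Dimock2013BalabanIII, proof of Corollary 1 (arXiv:1304.0705v1 TeX L2500–2505)] -/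
theorem abs_sum_activity_le [NeZero n] {H : Finset (TPt 3 n) → ℝ} {C lam β κ₀ K : ℝ}
    (hH : ActivityBound n H C lam β κ₀) (hS : Summing0 n κ₀ K) (hC : 0 ≤ C) (hlam : 0 ≤ lam) :
    |∑ X ∈ polymers n, H X| ≤ C * lam ^ (β / 2) * K * (n : ℝ) ^ 3 := by
  classical
  have hpow : 0 ≤ C * lam ^ (β / 2) := mul_nonneg hC (rpow_nonneg hlam _)
  calc |∑ X ∈ polymers n, H X| ≤ ∑ X ∈ polymers n, |H X| := abs_sum_le_sum_abs _ _
    _ ≤ ∑ c : TPt 3 n, ∑ X ∈ polymersAt n c, |H X| :=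
        sum_polymers_le_sum_polymersAt (fun X => |H X|) fun X => abs_nonneg _
    _ ≤ ∑ c : TPt 3 n, ∑ X ∈ polymersAt n c, C * lam ^ (β / 2) * exp (-κ₀ * torusTreeLen X) :=
        sum_le_sum fun c _ => sum_le_sum fun X hX => hH X (mem_polymers_of_mem_polymersAt hX)
    _ = ∑ c : TPt 3 n, C * lam ^ (β / 2) * ∑ X ∈ polymersAt n c, exp (-κ₀ * torusTreeLen X) := by
        refine sum_congr rfl fun c _ => ?_
        rw [mul_sum]
    _ ≤ ∑ _c : TPt 3 n, C * lam ^ (β / 2) * K :=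
        sum_le_sum fun c _ => mul_le_mul_of_nonneg_left (hS c) hpow
    _ = C * lam ^ (β / 2) * K * (n : ℝ) ^ 3 := by
        rw [sum_const, card_univ, card_tpt, nsmul_eq_mul]
        push_cast
        ring

/-! ## Part 4. PROVED: Theorem 2 ⇒ Corollary 1 (stability) -/

/-- From a representation `Z = exp(S)` with `|S| ≤ B`: the two-sided bound `exp(−B) ≤ Z ≤ exp(B)`. [folklore] -/
theorem two_sided_of_exp_repr {Z S B : ℝ} (hZ : Z = exp S) (hS : |S| ≤ B) : exp (-B) ≤ Z ∧ Z ≤ exp B := by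
  rw [hZ, exp_le_exp, exp_le_exp]
  constructor <;> linarith [neg_abs_le S, le_abs_self S]

/-- **THEOREM 2 ⇒ COROLLARY 1, general form**: the representation (soso), the activity bound (such) and (summing0)
give `exp(−B) ≤ Z_{𝖬,𝖭}/Z_{𝖬,𝖭}(0) ≤ exp(B)` with `B = C K₀ λ^{β/2} n³` (`n³ = |𝕋^{−𝖭}_𝖬|_M = M^{−3} Vol(𝕋_𝖬)`).
[cite: Dimock2013BalabanIII, Corollary 1 and its proof (arXiv:1304.0705v1 TeX L2491–2505)] -/
theorem stability_of_polymerRepresentation {L Mv N : ℕ} [NeZero L] [NeZero n] {lam ε₀ μ₀ : ℝ}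
    {H : Finset (TPt 3 n) → ℝ} {C β κ₀ K : ℝ} (hrep : PolymerRepresentation L Mv N n lam ε₀ μ₀ H)
    (hH : ActivityBound n H C lam β κ₀) (hS : Summing0 n κ₀ K) (hC : 0 ≤ C) (hlam : 0 ≤ lam) :
    exp (-(C * lam ^ (β / 2) * K * (n : ℝ) ^ 3)) ≤ relativePartitionFunction L Mv N 1 lam ε₀ μ₀ ∧
      relativePartitionFunction L Mv N 1 lam ε₀ μ₀ ≤ exp (C * lam ^ (β / 2) * K * (n : ℝ) ^ 3) :=
  two_sided_of_exp_repr hrep (abs_sum_activity_le hH hS hC hlam)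

/-- The cube count of the final torus: with `M = L^m`-cubes and `n = L^{𝖬−m}` cubes per direction (`m ≤ 𝖬`),
`M³ · n³ = L^{3𝖬} = Vol(𝕋_𝖬)` — the identity *"|𝕋^{−𝖭}_𝖬|_M = M^{−3} Vol(𝕋_𝖬)"* ([Dimock2013] L1341: *"|X|_M =
Vol(X)/M³ = number of M-cubes in X"*; cubes *"with side of length M = L^m"*, L1163). [cite: Dimock2013BalabanIII, proof of Corollary 1 (arXiv:1304.0705v1 TeX L2500–2505)] -/
theorem cubeCount_mul_eq (L m Mv : ℕ) (hm : m ≤ Mv) :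
    ((L : ℝ) ^ m) ^ 3 * ((L : ℝ) ^ (Mv - m)) ^ 3 = (L : ℝ) ^ (3 * Mv) := by
  rw [← mul_pow, ← pow_add, Nat.add_sub_cancel' hm, ← pow_mul, mul_comm]

/-- **THEOREM 2 ⇒ COROLLARY 1 AS PRINTED (`η = β/2`)**: with `M = L^m`-cubes, `n = L^{𝖬−m}` (`m ≤ 𝖬`) and the
absorbed smallness `C·K₀ ≤ M³` (the last "≤" of *"𝒪(1) M^{−3} λ^{β/2} Vol(𝕋_𝖬) ≤ λ^{β/2} Vol(𝕋_𝖬)"*, *"This follows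
with η = β/2"*): `exp(−λ^{β/2} Vol(𝕋_𝖬)) ≤ 𝖹_{𝖬,𝖭}/𝖹_{𝖬,𝖭}(0) ≤ exp(λ^{β/2} Vol(𝕋_𝖬))`, `Vol(𝕋_𝖬) = L^{3𝖬}` — the
inner inequality of `Phi43Stability.Dimock2014_phi43StabilityBound` at `η = β/2`. [cite: Dimock2013BalabanIII, Corollary 1 and its proof (arXiv:1304.0705v1 TeX L2491–2505)] -/
theorem stability_eta_half {L m Mv N : ℕ} [NeZero L] [NeZero (L ^ (Mv - m))] {lam ε₀ μ₀ : ℝ}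
    {H : Finset (TPt 3 (L ^ (Mv - m))) → ℝ} {C β κ₀ K : ℝ} (hm : m ≤ Mv)
    (hrep : PolymerRepresentation L Mv N (L ^ (Mv - m)) lam ε₀ μ₀ H)
    (hH : ActivityBound (L ^ (Mv - m)) H C lam β κ₀) (hS : Summing0 (L ^ (Mv - m)) κ₀ K)
    (hC : 0 ≤ C) (hlam : 0 ≤ lam) (hM : C * K ≤ ((L : ℝ) ^ m) ^ 3) :
    exp (-(lam ^ (β / 2) * (L : ℝ) ^ (3 * Mv))) ≤ relativePartitionFunction L Mv N 1 lam ε₀ μ₀ ∧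
      relativePartitionFunction L Mv N 1 lam ε₀ μ₀ ≤ exp (lam ^ (β / 2) * (L : ℝ) ^ (3 * Mv)) := by
  have h := stability_of_polymerRepresentation hrep hH hS hC hlam
  have hn : (((L ^ (Mv - m) : ℕ) : ℝ)) ^ 3 = ((L : ℝ) ^ (Mv - m)) ^ 3 := by push_cast; ring
  rw [hn] at h
  -- B = C λ^{β/2} K n³ ≤ λ^{β/2} M³ n³ = λ^{β/2} L^{3𝖬}
  have hpow : 0 ≤ lam ^ (β / 2) := rpow_nonneg hlam _
  have hn3 : 0 ≤ ((L : ℝ) ^ (Mv - m)) ^ 3 := by positivity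
  have hB : C * lam ^ (β / 2) * K * ((L : ℝ) ^ (Mv - m)) ^ 3 ≤ lam ^ (β / 2) * (L : ℝ) ^ (3 * Mv) := by
    rw [← cubeCount_mul_eq L m Mv hm]
    have : C * lam ^ (β / 2) * K * ((L : ℝ) ^ (Mv - m)) ^ 3
        = (C * K) * (lam ^ (β / 2) * ((L : ℝ) ^ (Mv - m)) ^ 3) := by ring
    rw [this]
    have : lam ^ (β / 2) * (((L : ℝ) ^ m) ^ 3 * ((L : ℝ) ^ (Mv - m)) ^ 3)
        = ((L : ℝ) ^ m) ^ 3 * (lam ^ (β / 2) * ((L : ℝ) ^ (Mv - m)) ^ 3) := by ring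
    rw [this]
    exact mul_le_mul_of_nonneg_right hM (mul_nonneg hpow hn3)
  constructor
  · exact le_trans (by rw [exp_le_exp]; linarith) h.1
  · exact le_trans h.2 (by rw [exp_le_exp]; linarith)

/-- **THEOREM 2 ⇒ COROLLARY 1 with (summing0) DISCHARGED**: the same conclusion from the representation and the
activity bound at any rate `κ₀ ≥ κ₀(32, 6)`, the constant being the cell's `K₀(32, 6)` (Part 2); hypotheses left
are Theorem 2's content and the absorbed smallness `C·K₀(32,6) ≤ M³`. [cite: Dimock2013BalabanIII, Corollary 1 and its proof (arXiv:1304.0705v1 TeX L2491–2505)] -/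
theorem stability_eta_half_kappa₀ {L m Mv N : ℕ} [NeZero L] [NeZero (L ^ (Mv - m))] {lam ε₀ μ₀ : ℝ}
    {H : Finset (TPt 3 (L ^ (Mv - m))) → ℝ} {C β κ₀ : ℝ} (hm : m ≤ Mv) (hκ : kappa₀ 32 6 ≤ κ₀)
    (hrep : PolymerRepresentation L Mv N (L ^ (Mv - m)) lam ε₀ μ₀ H)
    (hH : ActivityBound (L ^ (Mv - m)) H C lam β κ₀)
    (hC : 0 ≤ C) (hlam : 0 ≤ lam) (hM : C * K₀ 32 6 ≤ ((L : ℝ) ^ m) ^ 3) :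
    exp (-(lam ^ (β / 2) * (L : ℝ) ^ (3 * Mv))) ≤ relativePartitionFunction L Mv N 1 lam ε₀ μ₀ ∧
      relativePartitionFunction L Mv N 1 lam ε₀ μ₀ ≤ exp (lam ^ (β / 2) * (L : ℝ) ^ (3 * Mv)) :=
  stability_eta_half hm hrep hH (summing0_of_kappa₀_le (L ^ (Mv - m)) hκ) hC hlam hM

/-- **Any `η < β/2` under λ-smallness instead of `M`-largeness** (the other reading of *"for some η > 0 independent
[of] 𝖬, 𝖭"*): if `C·K·λ^{β/2−η} ≤ M³` then `exp(−λ^η Vol) ≤ Z/Z(0) ≤ exp(λ^η Vol)`. [cite: Dimock2013BalabanIII, Corollary 1 and its proof (arXiv:1304.0705v1 TeX L2491–2505)] -/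
theorem stability_eta {L m Mv N : ℕ} [NeZero L] [NeZero (L ^ (Mv - m))] {lam ε₀ μ₀ : ℝ}
    {H : Finset (TPt 3 (L ^ (Mv - m))) → ℝ} {C β κ₀ K η : ℝ} (hm : m ≤ Mv)
    (hrep : PolymerRepresentation L Mv N (L ^ (Mv - m)) lam ε₀ μ₀ H)
    (hH : ActivityBound (L ^ (Mv - m)) H C lam β κ₀) (hS : Summing0 (L ^ (Mv - m)) κ₀ K)
    (hC : 0 ≤ C) (hlam : 0 < lam) (hM : C * K * lam ^ (β / 2 - η) ≤ ((L : ℝ) ^ m) ^ 3) :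
    exp (-(lam ^ η * (L : ℝ) ^ (3 * Mv))) ≤ relativePartitionFunction L Mv N 1 lam ε₀ μ₀ ∧
      relativePartitionFunction L Mv N 1 lam ε₀ μ₀ ≤ exp (lam ^ η * (L : ℝ) ^ (3 * Mv)) := by
  have h := stability_of_polymerRepresentation hrep hH hS hC hlam.le
  have hn : (((L ^ (Mv - m) : ℕ) : ℝ)) ^ 3 = ((L : ℝ) ^ (Mv - m)) ^ 3 := by push_cast; ring
  rw [hn] at h
  have hsplit : lam ^ (β / 2) = lam ^ (β / 2 - η) * lam ^ η := by
    rw [← rpow_add hlam]; ring_nf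
  have hpow : 0 ≤ lam ^ η := rpow_nonneg hlam.le _
  have hn3 : 0 ≤ ((L : ℝ) ^ (Mv - m)) ^ 3 := by positivity
  have hB : C * lam ^ (β / 2) * K * ((L : ℝ) ^ (Mv - m)) ^ 3 ≤ lam ^ η * (L : ℝ) ^ (3 * Mv) := by
    rw [← cubeCount_mul_eq L m Mv hm, hsplit]
    have : C * (lam ^ (β / 2 - η) * lam ^ η) * K * ((L : ℝ) ^ (Mv - m)) ^ 3
        = (C * K * lam ^ (β / 2 - η)) * (lam ^ η * ((L : ℝ) ^ (Mv - m)) ^ 3) := by ring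
    rw [this]
    have : lam ^ η * (((L : ℝ) ^ m) ^ 3 * ((L : ℝ) ^ (Mv - m)) ^ 3)
        = ((L : ℝ) ^ m) ^ 3 * (lam ^ η * ((L : ℝ) ^ (Mv - m)) ^ 3) := by ring
    rw [this]
    exact mul_le_mul_of_nonneg_right hM (mul_nonneg hpow hn3)
  constructor
  · exact le_trans (by rw [exp_le_exp]; linarith) h.1
  · exact le_trans h.2 (by rw [exp_le_exp]; linarith)

end Literature.MathematicalPhysics.QuantumFieldTheory.Dimock2011to13

end

/-! # v2 (append-only): Part 5 — the exponentiation step (swat) ⇒ (soso) ∧ (such) on the torus polymer gas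

[Dimock2013BalabanIII] proof of Theorem 2 (TeX L2470–2480), verbatim: *"Recall that  𝖹_{𝖬,𝖭} = 𝖹_{𝖬,𝖭}(0) Σ_{{U_ℓ}}
Π_ℓ 𝒦(U_ℓ).  Since 𝒦(U) satisfies the bound (swat), and since 𝒪(1)λ^{β/2} is small, by a standard theorem (Appendix B,
part I) we can exponentiate the sum to the form (soso) with |ℋ(X)| ≤ 𝒪(1) λ^{β/2} e^{−(κ′−4κ₀−4) d_M(X)}"*; the sum is
the one of §3.1 (stingray) (L1535–1538): *"𝖹_{𝖬,𝖭} = 𝖹_{𝖬,𝖭}(0) Σ_{{U_ℓ}} Π_ℓ 𝒦(U_ℓ) where the sum is over disjoint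
connected {U_ℓ}"*, with (L1508–1510) *"where now we say X, Y are connected if they have a cube □ in common"*; the
"standard theorem" is [Dimock2013] App. B Theorem 27 (`\label{cluster}`, L3178–3194: *"if H(X,Φ) satisfies |H(X,Φ)| ≤
H₀e^{−κ d_M(X)} … with κ > 3κ₀ + 3 and H₀ ≤ c₀ then Ξ = exp(Σ_Y H^#(Y)) where H^#(Y) only depends on H(X) for X ⊂ Y
and |H^#(Y)| ≤ 𝒪(1)H₀e^{−(κ−3κ₀−3)d_M(Y)}"*), whose step 1 (L3204–3219) sums over *"collections of disjoint polymers
{Y_j}"* — a HARD-CORE POLYMER GAS WITH INCOMPATIBILITY = OVERLAP (a common cube).  Below this step is PROVED for the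
torus polymers of Part 1 with the tree-proved Kotecký–Preiss theorem ([KoteckyPreiss1986], `Literature.Probability.
LatticeModels.ClusterExpansion`) as the engine, run through unit pv18's `B13Resummation.{kp_condition,
exp_sum_locE_eq_Z, norm_locE_le_of_small}` and the geometric inputs of unit pv22's `TreeLengthTorusGeometry.tgeometry`
((1.26)/(summing0), the additive volume bound, (2.27) on the torus — all THEOREMS there): `Overlap` (Dimock's
incompatibility), `ComponentRepresentation` ((stingray) as a hypothesis shape: the relative partition function IS the
polymer partition function of the overlap gas with real activities 𝒦), `ComponentActivityBound` ((swat) as a hypothesis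
shape), `clusterH 𝒦` (ℋ := the real part of the X-localized cluster functional `locE`, [KP86] form of H^#),
`tFaceConnected_biUnion_of_isPolymerCluster` + `locE_eq_zero_of_not_mem_polymers` + `sum_image_locE_eq_sum_polymers`
(the cluster expansion is supported on POLYMERS = connected unions, which is why (soso) sums over them),
`isKPVolume_torus` (the KP condition of the torus gas), and the two deliverables `polymerRepresentation_of_components`
((stingray) ∧ (swat) ⇒ (soso) ∧ (such), constants e·c₁·K₀²·𝒪(1) and rate r₁ for any R ≥ r₁ + 2κ₀ + 2 under the KP
smallness 𝒪(1)λ^{β/2}e^{5r₁+1}K₀c₁ ≤ 1) and `stability_of_components` ((stingray) ∧ (swat) ⇒ Corollary 1, assembled with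
Part 4).  CONSTANTS DIFFER from App. B's (rate loss 2κ₀(32,6) + 2 and a λ-smallness, vs. 3κ₀ + 3 at H₀ ≤ c₀): a
different published engine for the same step (cell DIVERGENCE, KP vs D1 App. B); nothing printed is contradicted.
NOT CLAIMED: (stingray) itself (the large-field rearrangement of §3.1) and Lemma 17 (swat) — they are the hypotheses. -/

noncomputable section

open Real Finset
open Literature.Probability.LatticeModels
open Literature.MathematicalPhysics.QuantumFieldTheory.Balaban1983to89
open Literature.MathematicalPhysics.QuantumFieldTheory.Balaban1983to89.TreeLengthTorus
open Literature.MathematicalPhysics.QuantumFieldTheory.Balaban1983to89.TreeLengthTorusGeometry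
open Literature.MathematicalPhysics.QuantumFieldTheory.Balaban1983to89.B13Resummation
open Literature.MathematicalPhysics.QuantumFieldTheory.Balaban1983to89.B13FamilySum
open Literature.MathematicalPhysics.QuantumFieldTheory.Balaban1983to89.B12TreeDecay (kappa₀ K₀ K₀_pos)

namespace Literature.MathematicalPhysics.QuantumFieldTheory.Dimock2011to13

variable {n : ℕ} [NeZero n]

/-! ## Part 5a. Dimock's incompatibility (overlap), clusters and connected unions -/

/-- **Dimock's incompatibility of the final polymer gas**: two polymers are incompatible iff they have a cube in common —
[Dimock2013BalabanIII] §3.1, verbatim: *"where now we say X, Y are connected if they have a cube □ in common"*, the sum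
(stingray) being *"over disjoint connected {U_ℓ}"*; = [Dimock2013] App. B step 1 *"collections of disjoint polymers
{Y_j}"*. [cite: Dimock2013BalabanIII, §3.1 eq. (stingray) (arXiv:1304.0705v1 TeX L1508–1510, L1535–1538)] -/
def Overlap (Z Z' : TDom 3 n) : Prop := (Z.1 ∩ Z'.1).Nonempty

/-- Overlap is reflexive (a polymer has a cube). [folklore] -/
theorem overlap_refl (Z : TDom 3 n) : Overlap Z Z := by
  obtain ⟨a, ha⟩ := Z.2.1
  exact ⟨a, Finset.mem_inter.2 ⟨ha, ha⟩⟩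

/-- Overlap is symmetric. [folklore] -/
theorem overlap_symm (Z Z' : TDom 3 n) (h : Overlap Z Z') : Overlap Z' Z := by
  obtain ⟨a, ha⟩ := h
  exact ⟨a, by rwa [Finset.inter_comm]⟩

/-- Overlapping polymers touch (unit pv22's `TTouch` = [Balaban1988RG2Cluster] (2.11): a common cube OR a common wall). [folklore] -/
theorem ttouch_of_overlap {Z Z' : TDom 3 n} (h : Overlap Z Z') : TTouch Z Z' := by
  obtain ⟨a, ha⟩ := h
  exact ⟨a, (Finset.mem_inter.1 ha).1, a, (Finset.mem_inter.1 ha).2, Or.inl rfl⟩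

/-- Footprint-locality of the overlap through the polymer itself (`B13Resummation`'s `hloc` with reach = cubes, ν = 1). [folklore] -/
theorem loc_of_overlap {Z Z' : TDom 3 n} (h : Overlap Z' Z) : ∃ q ∈ Z.1, q ∈ Z'.1 := by
  obtain ⟨a, ha⟩ := h
  exact ⟨a, (Finset.mem_inter.1 ha).2, (Finset.mem_inter.1 ha).1⟩

/-- Clusters are monotone in the incompatibility relation. [folklore] -/
theorem isPolymerCluster_mono {P : Type*} [DecidableEq P] {inc inc' : P → P → Prop}
    (h : ∀ a b, inc a b → inc' a b) {C : Finset P} (hC : IsPolymerCluster inc C) : IsPolymerCluster inc' C :=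
  fun C₁ hC₁ h₁ h₂ => by
    obtain ⟨γ₁, hγ₁, γ₂, hγ₂, hi⟩ := hC C₁ hC₁ h₁ h₂
    exact ⟨γ₁, hγ₁, γ₂, hγ₂, h _ _ hi⟩

omit [NeZero n] in
/-- Chains inside a family persist inside any larger family. [folklore] -/
theorem tLinked_mono {S T : Finset (TPt 3 n)} (hST : S ⊆ T) {x y : TPt 3 n} (h : TLinked S x y) :
    TLinked T x y := by
  unfold TLinked at h ⊢
  induction h with
  | refl => exact Relation.ReflTransGen.refl
  | tail _ hbc ih => exact ih.tail ⟨hST hbc.1, hST hbc.2.1, hbc.2.2⟩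

open Classical in
/-- A CLUSTER of polymers for the incompatibility «share a cube or a wall» (`TTouch`) — a fortiori for Dimock's
«share a cube» — has a face-connected union: the cluster functionals of the polymer gas are supported on connected
unions of cubes, as in (soso) *"the sum is over connected unions of M cubes"*. [folklore] -/
theorem tFaceConnected_biUnion_of_isPolymerCluster {C : Finset (TDom 3 n)} (hC : IsPolymerCluster TTouch C) :
    TFaceConnected (C.biUnion fun U => U.1) := by
  classical
  set X := C.biUnion fun U : TDom 3 n => U.1 with hX
  intro x hx y hy
  obtain ⟨Zx, hZxC, hxZ⟩ := mem_biUnion.1 hx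
  obtain ⟨Zy, hZyC, hyZ⟩ := mem_biUnion.1 hy
  -- the members all of whose cubes are linked to x inside X
  set C₁ := C.filter fun W : TDom 3 n => ∀ w ∈ W.1, TLinked X x w with hC₁
  have hsubX : ∀ W ∈ C, W.1 ⊆ X := fun W hW => subset_biUnion_of_mem (fun U : TDom 3 n => U.1) hW
  have hZx1 : Zx ∈ C₁ := by
    rw [hC₁, mem_filter]
    exact ⟨hZxC, fun w hw => tLinked_mono (hsubX Zx hZxC) (Zx.2.2 x hxZ w hw)⟩
  -- C₁ = C, otherwise the cluster property produces a touching pair across the cut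
  have hall : C \ C₁ = ∅ := by
    by_contra hne
    have hne' : (C \ C₁).Nonempty := nonempty_iff_ne_empty.2 hne
    obtain ⟨W₁, hW₁, W₂, hW₂, htouch⟩ := hC C₁ (filter_subset _ _) ⟨Zx, hZx1⟩ hne'
    have hW₁' := (mem_filter.1 hW₁).2
    have hW₂C : W₂ ∈ C := (mem_sdiff.1 hW₂).1
    have hW₂not : W₂ ∉ C₁ := (mem_sdiff.1 hW₂).2
    apply hW₂not
    rw [hC₁, mem_filter]
    refine ⟨hW₂C, fun w hw => ?_⟩
    have htouch' : ∃ a ∈ W₁.1, ∃ b ∈ W₂.1, a = b ∨ TAdj a b := htouch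
    obtain ⟨a, ha, b, hb, hab⟩ := htouch'
    have hxa : TLinked X x a := hW₁' a ha
    have hab' : TLinked X a b := by
      rcases hab with hab | hab
      · rw [hab]; exact Relation.ReflTransGen.refl
      · exact Relation.ReflTransGen.single ⟨hsubX W₁ (mem_filter.1 hW₁).1 ha, hsubX W₂ hW₂C hb, hab⟩
    have hbw : TLinked X b w := tLinked_mono (hsubX W₂ hW₂C) (W₂.2.2 b hb w hw)
    exact (hxa.trans hab').trans hbw
  have hZy1 : Zy ∈ C₁ := by
    have : Zy ∈ C \ C₁ → False := fun h => by rw [hall] at h; exact absurd h (notMem_empty _)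
    by_contra hcon
    exact this (mem_sdiff.2 ⟨hZyC, hcon⟩)
  exact (mem_filter.1 hZy1).2 y hyZ

/-- The KP logarithm of the empty family vanishes (the ray derivative of `Z(∅; t w) ≡ 1` is `0`). [folklore] -/
theorem polymerLogZ_empty {P : Type*} [DecidableEq P] (inc : P → P → Prop) [DecidableRel inc] (w : P → ℂ) :
    polymerLogZ inc w (∅ : Finset P) = 0 := by
  unfold polymerLogZ
  have h : ∀ t : ℝ, polymerRayDeriv inc w ∅ t = 0 := by
    intro t
    unfold polymerRayDeriv
    refine Finset.sum_eq_zero fun X hX => ?_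
    have hX' : X = ∅ := Finset.subset_empty.1 (Finset.mem_powerset.1 (Finset.mem_filter.1 hX).1)
    rw [hX']
    simp
  simp_rw [h, zero_div]
  exact intervalIntegral.integral_zero

/-- Hence the truncated functional of the empty family vanishes. [folklore] -/
theorem truncatedWeight_empty {P : Type*} [DecidableEq P] (inc : P → P → Prop) [DecidableRel inc] (w : P → ℂ) :
    truncatedWeight inc w (∅ : Finset P) = 0 := by
  unfold truncatedWeight
  simp [polymerLogZ_empty]

/-! ## Part 5b. The Kotecký–Preiss condition of the torus overlap gas; support of the cluster expansion -/

open Classical in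
/-- **The torus polymer gas (overlap incompatibility) is a Kotecký–Preiss volume.**  For activities `w` with
`‖w(U)‖ ≤ A e^{−R d(U)}`, the geometric constants of `TreeLengthTorusGeometry.tgeometry 3 n` ((summing0)/(1.26) at rate
κ₀ with constant K₀, additive volume bound c₁; ALL THEOREMS there), reach = the polymer itself (ν = 1), the rate
condition κ₀ + τc₁ ≤ R and the smallness A e^{τc₁} K₀ ≤ τ give the finite-volume KP condition with size function
a(U) = τ·|U|_M — unit pv18's `B13Resummation.kp_condition` on the periodic carrier: the hypothesis under which the
*"standard theorem (Appendix B, part I)"* applies. [cite: Dimock2013BalabanIII, proof of Theorem 2 (arXiv:1304.0705v1 TeX L2470–2480)] -/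
theorem isKPVolume_torus {w : TDom 3 n → ℂ} {A R τ : ℝ} (hA : 0 ≤ A) (hτ : 0 ≤ τ)
    (hw : ∀ U : TDom 3 n, ‖w U‖ ≤ A * Real.exp (-(R * torusTreeLen U.1)))
    (hrate : (tgeometry 3 n).κ₀ + τ * (tgeometry 3 n).c₁ ≤ R)
    (hsmall : A * Real.exp (τ * (tgeometry 3 n).c₁) * (tgeometry 3 n).K₀ ≤ τ) :
    IsKPVolume Overlap w (fun U : TDom 3 n => τ * ((U.1.card : ℕ) : ℝ)) Finset.univ := by
  set G := tgeometry 3 n with hG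
  have hreach : ∀ Z : TDom 3 n, ((G.cubes Z).card : ℝ) ≤ 1 * (G.cubes Z).card := fun Z => by rw [one_mul]
  have hkp := kp_condition Overlap (cubes := G.cubes) (reach := G.cubes) (d := (tsys 3 n).dj) (w := w)
    (A := A) (R := R) (κ₀ := G.κ₀) (K₀ := G.K₀) (c₁ := G.c₁) (τ := τ) (s := 0) (b := 0) (ν := 1)
    (fun _ _ h => loc_of_overlap h) hreach (tsys 3 n).dj_nonneg hA G.K₀_nonneg hτ hw G.ineq126 G.volBound
    (by linarith) (by simpa using hsmall)
  have h1 := fun γ => kp_hypothesis_of_fintype (inc := Overlap) (w := w)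
    (a := fun Z : TDom 3 n => τ * ((G.cubes Z).card : ℝ)) (d := fun Z => 0 * (tsys 3 n).dj Z + 0) hkp γ
  exact isKPVolume_of_tsum_le (inc := Overlap) (w := w) (a := fun Z : TDom 3 n => τ * ((G.cubes Z).card : ℝ))
    (d := fun Z => 0 * (tsys 3 n).dj Z + 0) (fun Z => by simp) h1 Finset.univ

open Classical in
/-- In a KP volume the X-localized cluster functional `locE` of the overlap gas VANISHES unless X is a polymer (a
non-empty connected union of cubes): the empty family contributes Φ^T(∅) = 0, a non-empty covering family of a
disconnected or empty X is not a cluster (`tFaceConnected_biUnion_of_isPolymerCluster`), and Φ^T vanishes off clusters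
(tree-proved [KP86] Theorem, last assertion).  This is why (soso) sums over *"connected unions of M cubes"* and why
App. B's H^# is indexed by polymers Y. [cite: Dimock2013BalabanIII, Theorem 2 eq. (soso) (arXiv:1304.0705v1 TeX L2456–2459)] -/
theorem locE_eq_zero_of_not_mem_polymers {w : TDom 3 n → ℂ} {a : TDom 3 n → ℝ}
    (hKP : IsKPVolume Overlap w a Finset.univ) {X : Finset (TPt 3 n)} (hX : X ∉ polymers n) :
    locE Overlap (fun U : TDom 3 n => U.1) w X = 0 := by
  haveI : Std.Refl (Overlap (n := n)) := ⟨overlap_refl⟩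
  haveI : Std.Symm (Overlap (n := n)) := ⟨overlap_symm⟩
  unfold locE
  refine Finset.sum_eq_zero fun C hC => ?_
  have hCX : C.biUnion (fun U : TDom 3 n => U.1) = X := (mem_coveringFamilies.1 hC).2
  by_cases hCe : C = ∅
  · subst hCe
    exact truncatedWeight_empty Overlap w
  · refine truncatedWeight_eq_zero_of_kp hKP (Finset.subset_univ C) fun hcl => hX ?_
    rw [mem_polymers, ← hCX]
    refine ⟨?_, tFaceConnected_biUnion_of_isPolymerCluster
      (isPolymerCluster_mono (fun _ _ h => ttouch_of_overlap h) hcl)⟩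
    obtain ⟨U, hU⟩ := Finset.nonempty_iff_ne_empty.2 hCe
    obtain ⟨c, hc⟩ := U.2.1
    exact ⟨c, Finset.mem_biUnion.2 ⟨U, hU, hc⟩⟩

open Classical in
/-- Every polymer is the union of a (singleton) family of polymers. [folklore] -/
theorem mem_image_of_mem_polymers {X : Finset (TPt 3 n)} (hX : X ∈ polymers n) :
    X ∈ (Finset.univ : Finset (TDom 3 n)).powerset.image (fun C => C.biUnion fun U : TDom 3 n => U.1) := by
  rw [mem_polymers] at hX
  set Xd : TDom 3 n := ⟨X, hX⟩ with hXd
  refine Finset.mem_image.2 ⟨({Xd} : Finset (TDom 3 n)), Finset.mem_powerset.2 (Finset.subset_univ _), ?_⟩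
  rw [Finset.singleton_biUnion]

open Classical in
/-- **The cluster expansion is supported on polymers**: in a KP volume, the sum of the localized cluster functionals
over all unions of families of polymers equals the sum over the polymers. [cite: Dimock2013BalabanIII, Theorem 2 eq. (soso) (arXiv:1304.0705v1 TeX L2456–2459)] -/
theorem sum_image_locE_eq_sum_polymers {w : TDom 3 n → ℂ} {a : TDom 3 n → ℝ}
    (hKP : IsKPVolume Overlap w a Finset.univ) :
    ∑ X ∈ (Finset.univ : Finset (TDom 3 n)).powerset.image (fun C => C.biUnion fun U : TDom 3 n => U.1),
        locE Overlap (fun U : TDom 3 n => U.1) w X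
      = ∑ X ∈ polymers n, locE Overlap (fun U : TDom 3 n => U.1) w X := by
  symm
  exact Finset.sum_subset (fun X hX => mem_image_of_mem_polymers hX)
    fun X _ hX => locE_eq_zero_of_not_mem_polymers hKP hX

/-! ## Part 5c. (stingray) and (swat) as hypothesis shapes; ℋ := the localized cluster functional -/

open Classical in
/-- **The un-exponentiated representation (stingray), as a hypothesis shape** — [Dimock2013BalabanIII] §3.1, verbatim:
*"𝖹_{𝖬,𝖭} = 𝖹_{𝖬,𝖭}(0) Σ_{{U_ℓ}} Π_ℓ 𝒦(U_ℓ)  where the sum is over disjoint connected {U_ℓ}"* (recalled at the start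
of the proof of Theorem 2, L2471–2474): the relative partition function is the hard-core polymer partition function of
the torus gas with incompatibility `Overlap` and real activities 𝒦 (a sum over families of pairwise DISJOINT polymers).
NOT asserted (it is the large-field rearrangement of §3.1–3.4). [cite: Dimock2013BalabanIII, §3.1 eq. (stingray) (arXiv:1304.0705v1 TeX L1535–1543)] -/
def ComponentRepresentation (L Mv N n : ℕ) [NeZero L] [NeZero n] (lam ε₀ μ₀ : ℝ) (K : TDom 3 n → ℝ) : Prop :=
  ((relativePartitionFunction L Mv N 1 lam ε₀ μ₀ : ℝ) : ℂ) =
    polymerPartitionFunction Overlap (fun U : TDom 3 n => (K U : ℂ)) Finset.univ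

/-- **(swat) as a hypothesis shape** — [Dimock2013BalabanIII] Lemma 17, verbatim: *"|𝒦(U)| ≤ 𝒪(1) λ^{β/2}
e^{−(κ′−κ₀−1) d_M(U)}"* for every connected union U of M cubes, with 𝒪(1) displayed as `C` and the rate κ′ − κ₀ − 1
displayed as `R`. [cite: Dimock2013BalabanIII, Lemma 17 eq. (swat) (arXiv:1304.0705v1 TeX L2393–2397)] -/
def ComponentActivityBound (n : ℕ) [NeZero n] (K : TDom 3 n → ℝ) (C lam β R : ℝ) : Prop :=
  ∀ U : TDom 3 n, |K U| ≤ C * lam ^ (β / 2) * Real.exp (-(R * torusTreeLen U.1))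

open Classical in
/-- **ℋ(X)** := the X-localized part of the Kotecký–Preiss logarithm of the overlap gas — the real part of the sum of the
truncated functionals Φ^T(C) over the families C of polymers with ∪C = X ([Dimock2013] App. B Theorem 27's H^#(Y), *"only
depends on H(X) for X ⊂ Y"*; [KP86] form; [Balaban1988RG2Cluster] (2.13) as typed by unit pv18, `B13Resummation.locE`).
[cite: Dimock2013, App. B Theorem 27 (arXiv:1108.1335v2 TeX L3178–3194)] -/
def clusterH (K : TDom 3 n → ℝ) (X : Finset (TPt 3 n)) : ℝ :=
  (locE Overlap (fun U : TDom 3 n => U.1) (fun U => (K U : ℂ)) X).re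

/-- The constants of the torus geometry at d = 3: ν = 7, κ₀ = κ₀(32, 6), K₀ = K₀(32, 6), c₁ = 32 (only κ₀, K₀, c₁ are used
by the overlap gas, whose reach constant is 1). [folklore] -/
theorem tgeometry_three_consts (n : ℕ) [NeZero n] :
    (tgeometry 3 n).ν = 7 ∧ (tgeometry 3 n).κ₀ = kappa₀ 32 6 ∧
      (tgeometry 3 n).K₀ = K₀ 32 6 ∧ (tgeometry 3 n).c₁ = 32 := by
  obtain ⟨h1, h2, h3, h4⟩ := tgeometry_consts 3 n
  have e1 : ((4 : ℝ) * 2 ^ 3) = 32 := by norm_num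
  refine ⟨by rw [h1]; norm_num, by rw [h2, e1], by rw [h3, e1], by rw [h4]; norm_num⟩

/-! ## Part 5d. PROVED: (stingray) ∧ (swat) ⇒ (soso) ∧ (such) — the exponentiation step of the proof of Theorem 2 -/

open Classical in
/-- **THE EXPONENTIATION STEP OF THE PROOF OF THEOREM 2, PROVED on the torus polymer gas** — [Dimock2013BalabanIII],
verbatim: *"Since 𝒦(U) satisfies the bound (swat), and since 𝒪(1)λ^{β/2} is small, by a standard theorem (Appendix B,
part I) we can exponentiate the sum to the form (soso) with |ℋ(X)| ≤ 𝒪(1) λ^{β/2} e^{−(κ′−4κ₀−4) d_M(X)}"*.  Here the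
"standard theorem" is the tree-proved Kotecký–Preiss theorem run on the periodic carrier (unit pv18's
`B13Resummation.exp_sum_locE_eq_Z` / `norm_locE_le_of_small` with the geometric THEOREMS of unit pv22's `tgeometry`,
reach = the polymer, ν = 1): from (stingray) and (swat) with rate R ≥ r₁ + 2κ₀ + 2 and the smallness
C λ^{β/2} e^{5r₁+1} K₀ c₁ ≤ 1 one gets (soso) for ℋ := `clusterH 𝒦` (by taking norms in exp(Σ_X locE(X)) = Ξ:
‖e^S‖ = e^{Re S}, Ξ = 𝖹/𝖹(0) > 0) AND (such) with 𝒪(1) = e·c₁·K₀²·C at the rate r₁.  CONSTANTS DIFFER from App. B's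
(rate loss 2κ₀ + 2 and a λ-smallness, vs. 3κ₀ + 3 at H₀ ≤ c₀): a different published engine for the same step.
[cite: Dimock2013BalabanIII, proof of Theorem 2 (arXiv:1304.0705v1 TeX L2470–2482)] -/
theorem polymerRepresentation_of_components {L Mv N : ℕ} [NeZero L] {lam ε₀ μ₀ : ℝ} {K : TDom 3 n → ℝ}
    {C β R r₁ : ℝ} (hrep : ComponentRepresentation L Mv N n lam ε₀ μ₀ K)
    (hK : ComponentActivityBound n K C lam β R) (hC : 0 ≤ C) (hlam : 0 < lam) (hr₁ : 0 ≤ r₁)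
    (hrate : r₁ + 2 * (tgeometry 3 n).κ₀ + 2 ≤ R)
    (hsmall : C * lam ^ (β / 2) * Real.exp (5 * r₁ + 1) * (tgeometry 3 n).K₀ * (tgeometry 3 n).c₁ ≤ 1) :
    PolymerRepresentation L Mv N n lam ε₀ μ₀ (clusterH K) ∧
      ActivityBound n (clusterH K) (Real.exp 1 * (tgeometry 3 n).c₁ * (tgeometry 3 n).K₀ ^ 2 * C) lam β r₁ := by
  set G := tgeometry 3 n with hG
  haveI : Std.Refl (Overlap (n := n)) := ⟨overlap_refl⟩
  haveI : Std.Symm (Overlap (n := n)) := ⟨overlap_symm⟩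
  have hreach : ∀ Z : TDom 3 n, ((G.cubes Z).card : ℝ) ≤ 1 * (G.cubes Z).card := fun Z => by rw [one_mul]
  have hloc : ∀ Z Z' : TDom 3 n, Overlap Z' Z → ∃ q ∈ G.cubes Z, q ∈ G.cubes Z' := fun _ _ h => loc_of_overlap h
  set A : ℝ := C * lam ^ (β / 2) with hA_def
  have hA : 0 ≤ A := mul_nonneg hC (rpow_nonneg hlam.le _)
  set w : TDom 3 n → ℂ := fun U => (K U : ℂ) with hw_def
  have hw : ∀ U : TDom 3 n, ‖w U‖ ≤ A * Real.exp (-(R * torusTreeLen U.1)) := fun U => by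
    rw [hw_def]
    simp only [Complex.norm_real, Real.norm_eq_abs]
    exact hK U
  -- the KP smallness: τ := A e^{5r₁+1} K₀ (reach constant 1), with τ c₁ ≤ 1
  set τ : ℝ := A * Real.exp (5 * r₁ + 1) * G.K₀ with hτ_def
  have hτ : 0 ≤ τ := mul_nonneg (mul_nonneg hA (Real.exp_nonneg _)) G.K₀_nonneg
  have hτc : τ * G.c₁ ≤ 1 := by rw [hτ_def]; exact hsmall
  have hκ₀ := G.κ₀_nonneg
  have hAK : 0 ≤ A * G.K₀ := mul_nonneg hA G.K₀_nonneg
  have hsmallKP : A * Real.exp (τ * G.c₁) * G.K₀ ≤ τ := by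
    rw [hτ_def]
    have hexpτ : Real.exp (τ * G.c₁) ≤ Real.exp (5 * r₁ + 1) := Real.exp_le_exp.2 (by linarith)
    have e1 : A * Real.exp (τ * G.c₁) * G.K₀ = A * G.K₀ * Real.exp (τ * G.c₁) := by ring
    have e2 : A * Real.exp (5 * r₁ + 1) * G.K₀ = A * G.K₀ * Real.exp (5 * r₁ + 1) := by ring
    rw [e1, e2]
    exact mul_le_mul_of_nonneg_left hexpτ hAK
  have hrateKP : G.κ₀ + τ * G.c₁ ≤ R := by linarith
  have hKP := isKPVolume_torus (w := w) hA hτ hw hrateKP hsmallKP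
  -- (soso): exponentiate with `exp_sum_locE_eq_Z` (s = 0, b = 5 r₁, ν = 1)
  have hsmallE : A * Real.exp (5 * r₁ + τ * G.c₁) * G.K₀ * 1 ≤ τ := by
    rw [mul_one, hτ_def]
    have hexp' : Real.exp (5 * r₁ + τ * G.c₁) ≤ Real.exp (5 * r₁ + 1) := Real.exp_le_exp.2 (by linarith)
    have e1 : A * Real.exp (5 * r₁ + τ * G.c₁) * G.K₀ = A * G.K₀ * Real.exp (5 * r₁ + τ * G.c₁) := by ring
    have e2 : A * Real.exp (5 * r₁ + 1) * G.K₀ = A * G.K₀ * Real.exp (5 * r₁ + 1) := by ring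
    rw [e1, e2]
    exact mul_le_mul_of_nonneg_left hexp' hAK
  have hexpZ := exp_sum_locE_eq_Z Overlap (cubes := G.cubes) (reach := G.cubes) (d := (tsys 3 n).dj) (w := w)
    (A := A) (R := R) (κ₀ := G.κ₀) (K₀ := G.K₀) (c₁ := G.c₁) (τ := τ) (s := 0) (b := 5 * r₁) (ν := 1)
    hloc hreach (tsys 3 n).dj_nonneg hA G.K₀_nonneg hτ le_rfl (by linarith) hw G.ineq126 G.volBound
    (by linarith) hsmallE
  have hsum := sum_image_locE_eq_sum_polymers (n := n) hKP
  have hexpZ' : Complex.exp (∑ X ∈ polymers n, locE Overlap (fun U : TDom 3 n => U.1) w X) =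
      ((relativePartitionFunction L Mv N 1 lam ε₀ μ₀ : ℝ) : ℂ) := by
    rw [← hsum]
    exact hexpZ.trans hrep.symm
  have hpos : 0 < relativePartitionFunction L Mv N 1 lam ε₀ μ₀ :=
    relativePartitionFunction_pos L Mv N one_pos hlam ε₀ μ₀
  refine ⟨?_, ?_⟩
  · -- take norms: ‖exp S‖ = exp (Re S), ‖(r : ℂ)‖ = r for r ≥ 0
    have hnorm := congrArg (fun z : ℂ => ‖z‖) hexpZ'
    simp only [Complex.norm_exp, Complex.norm_of_nonneg hpos.le, Complex.re_sum] at hnorm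
    unfold PolymerRepresentation clusterH
    exact hnorm.symm
  · intro X hX
    have hX' := mem_polymers.1 hX
    set Xd : TDom 3 n := ⟨X, hX'⟩ with hXd
    have hsmall1 : A * Real.exp (5 * r₁ + 1) * G.K₀ * 1 * G.c₁ ≤ 1 := by rw [mul_one]; exact hsmall
    have h := norm_locE_le_of_small Overlap (cubes := G.cubes) (reach := G.cubes) (d := (tsys 3 n).dj) (w := w)
      (A := A) (R := R) (r₁ := r₁) (κ₀ := G.κ₀) (K₀ := G.K₀) (c₁ := G.c₁) (c := 5) (b := 5 * r₁) (ν := 1)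
      (dX := torusTreeLen X) (X := X)
      hloc hreach (tsys 3 n).dj_nonneg hA G.K₀_nonneg G.c₁_nonneg zero_le_one G.κ₀_nonneg hr₁
      (by norm_num) (le_of_eq (by ring)) (fun Z _ => hw Z) G.ineq126 G.volBound (G.ineq227 Xd) hrate hsmall1 hX'.1
    calc |clusterH K X| ≤ ‖locE Overlap (fun U : TDom 3 n => U.1) w X‖ := Complex.abs_re_le_norm _
      _ ≤ Real.exp 1 * 1 * G.c₁ * G.K₀ ^ 2 * A * Real.exp (-(r₁ * torusTreeLen X)) := h
      _ = Real.exp 1 * G.c₁ * G.K₀ ^ 2 * C * lam ^ (β / 2) * Real.exp (-r₁ * torusTreeLen X) := by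
          rw [hA_def, neg_mul]; ring

open Classical in
/-- **(stingray) ∧ (swat) ⇒ THEOREM 2 ⇒ COROLLARY 1, assembled** (d = 3 constants c₁ = 32, κ₀ = κ₀(32,6), K₀ = K₀(32,6)):
from the component representation and (swat) at a rate R ≥ r₁ + 2κ₀(32,6) + 2 with r₁ ≥ κ₀(32,6), the KP smallness
C λ^{β/2} e^{5r₁+1} K₀(32,6)·32 ≤ 1, M = L^m-cubes with m ≤ 𝖬, and the absorbed smallness (e·32·K₀(32,6)²·C)·K₀(32,6) ≤ M³:
the printed stability bound e^{−λ^{β/2}Vol(𝕋_𝖬)} ≤ 𝖹_{𝖬,𝖭}/𝖹_{𝖬,𝖭}(0) ≤ e^{λ^{β/2}Vol(𝕋_𝖬)} — the last TWO implications of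
the trilogy kernel-checked over the cell's polymer model, with (stingray) (the large-field rearrangement of §3.1–3.4) and
Lemma 17 (swat) as the hypotheses. [cite: Dimock2013BalabanIII, Theorem 2 and Corollary 1 (arXiv:1304.0705v1 TeX L2452–2505)] -/
theorem stability_of_components {L m Mv N : ℕ} [NeZero L] [NeZero (L ^ (Mv - m))] {lam ε₀ μ₀ : ℝ}
    {K : TDom 3 (L ^ (Mv - m)) → ℝ} {C β R r₁ : ℝ} (hm : m ≤ Mv)
    (hrep : ComponentRepresentation L Mv N (L ^ (Mv - m)) lam ε₀ μ₀ K)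
    (hK : ComponentActivityBound (L ^ (Mv - m)) K C lam β R) (hC : 0 ≤ C) (hlam : 0 < lam)
    (hr₁ : kappa₀ 32 6 ≤ r₁) (hrate : r₁ + 2 * kappa₀ 32 6 + 2 ≤ R)
    (hsmall : C * lam ^ (β / 2) * Real.exp (5 * r₁ + 1) * K₀ 32 6 * 32 ≤ 1)
    (hM : Real.exp 1 * 32 * K₀ 32 6 ^ 2 * C * K₀ 32 6 ≤ ((L : ℝ) ^ m) ^ 3) :
    Real.exp (-(lam ^ (β / 2) * (L : ℝ) ^ (3 * Mv))) ≤ relativePartitionFunction L Mv N 1 lam ε₀ μ₀ ∧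
      relativePartitionFunction L Mv N 1 lam ε₀ μ₀ ≤ Real.exp (lam ^ (β / 2) * (L : ℝ) ^ (3 * Mv)) := by
  obtain ⟨-, hκ, hK0, hc⟩ := tgeometry_three_consts (L ^ (Mv - m))
  have hκ₀nn : 0 ≤ kappa₀ 32 6 := by rw [← hκ]; exact (tgeometry 3 (L ^ (Mv - m))).κ₀_nonneg
  have h := polymerRepresentation_of_components (n := L ^ (Mv - m)) (r₁ := r₁) hrep hK hC hlam
    (le_trans hκ₀nn hr₁) (by rw [hκ]; exact hrate) (by rw [hK0, hc]; exact hsmall)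
  rw [hc, hK0] at h
  exact stability_eta_half hm h.1 h.2 (summing0_of_kappa₀_le (L ^ (Mv - m)) hr₁)
    (by positivity) hlam.le hM


/-! ## Part 6 (v2.1). PROVED: the last line of §3.6 before Theorem 2 — (toot) ⇒ (swat) (Lemma 17) by the volume bound -/

/-- **(toot) as a hypothesis shape** — [Dimock2013BalabanIII] (toot), verbatim: *"|𝒦(U)| ≤ λ^{β/2} exp(−(κ′−κ₀) d_M(U) +
𝒪(1) λ^{β/2} |U|_M)"* for every connected union U of M cubes (the output of the three polymer resummations (under3) of
§3.6; 𝒪(1) displayed as `c`, κ′ − κ₀ as `R + 1`). [cite: Dimock2013BalabanIII, §3.6 eq. (toot) (arXiv:1304.0705v1 TeX L2439–2441)] -/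
def TootBound (n : ℕ) [NeZero n] (K : TDom 3 n → ℝ) (c lam β R : ℝ) : Prop :=
  ∀ U : TDom 3 n, |K U| ≤ lam ^ (β / 2) *
    Real.exp (-((R + 1) * torusTreeLen U.1) + c * lam ^ (β / 2) * (U.1.card : ℝ))

/-- **(toot) ⇒ (swat) = Lemma 17, PROVED** — [Dimock2013BalabanIII], verbatim: *"This is sufficient since |U|_M ≤ 𝒪(1)(d_M(U)
+ 𝒪(1)) and λ is small."*: with the cell's volume bound ON THE TORUS |U|_M ≤ 2³(4 d_M(U) + 1) (unit pv22's
`TreeLengthTorus.card_le_torusTreeLen`, the repaired additive form of [Balaban1988RG2Cluster] (2.30) = [Dimock2013BalabanII]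
App. E Lemma E.1 (3) in substance) and the smallness 32·c·λ^{β/2} ≤ 1, (toot) at rate κ′ − κ₀ = R + 1 gives (swat)
|𝒦(U)| ≤ e^{1/4} λ^{β/2} e^{−R d_M(U)} — the printed rate loss of exactly 1 (κ′ − κ₀ ↦ κ′ − κ₀ − 1) with 𝒪(1) = e^{1/4}.
[cite: Dimock2013BalabanIII, Lemma 17 eq. (swat) and (toot) (arXiv:1304.0705v1 TeX L2393–2397, L2439–2442)] -/
theorem componentActivityBound_of_toot {K : TDom 3 n → ℝ} {c lam β R : ℝ} (hK : TootBound n K c lam β R)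
    (hc : 0 ≤ c) (hlam : 0 ≤ lam) (hsmall : 32 * c * lam ^ (β / 2) ≤ 1) :
    ComponentActivityBound n K (Real.exp (1 / 4)) lam β R := by
  intro U
  have hvol : (U.1.card : ℝ) ≤ 2 ^ 3 * (4 * torusTreeLen U.1 + 1) := card_le_torusTreeLen U.2.1 U.2.2
  have hd : 0 ≤ torusTreeLen U.1 := torusTreeLen_nonneg U.1
  have hcl : 0 ≤ c * lam ^ (β / 2) := mul_nonneg hc (rpow_nonneg hlam _)
  -- c λ^{β/2} |U| ≤ c λ^{β/2} (32 d + 8) ≤ d + 1/4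
  have h1 : c * lam ^ (β / 2) * (U.1.card : ℝ) ≤ torusTreeLen U.1 + 1 / 4 := by
    have h2 : c * lam ^ (β / 2) * (U.1.card : ℝ) ≤ c * lam ^ (β / 2) * (32 * torusTreeLen U.1 + 8) := by
      refine mul_le_mul_of_nonneg_left ?_ hcl
      have : (2 : ℝ) ^ 3 * (4 * torusTreeLen U.1 + 1) = 32 * torusTreeLen U.1 + 8 := by ring
      linarith
    have h3 : c * lam ^ (β / 2) * (32 * torusTreeLen U.1 + 8)
        = (32 * c * lam ^ (β / 2)) * torusTreeLen U.1 + (32 * c * lam ^ (β / 2)) * (1 / 4) := by ring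
    have h4 : (32 * c * lam ^ (β / 2)) * torusTreeLen U.1 ≤ 1 * torusTreeLen U.1 :=
      mul_le_mul_of_nonneg_right hsmall hd
    have h5 : (32 * c * lam ^ (β / 2)) * (1 / 4) ≤ 1 * (1 / 4) :=
      mul_le_mul_of_nonneg_right hsmall (by norm_num)
    linarith
  have hexp : Real.exp (-((R + 1) * torusTreeLen U.1) + c * lam ^ (β / 2) * (U.1.card : ℝ))
      ≤ Real.exp (1 / 4) * Real.exp (-(R * torusTreeLen U.1)) := by
    rw [← Real.exp_add, Real.exp_le_exp]
    linarith
  calc |K U| ≤ lam ^ (β / 2) * Real.exp (-((R + 1) * torusTreeLen U.1) + c * lam ^ (β / 2) * (U.1.card : ℝ)) := hK U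
    _ ≤ lam ^ (β / 2) * (Real.exp (1 / 4) * Real.exp (-(R * torusTreeLen U.1))) :=
        mul_le_mul_of_nonneg_left hexp (rpow_nonneg hlam _)
    _ = Real.exp (1 / 4) * lam ^ (β / 2) * Real.exp (-(R * torusTreeLen U.1)) := by ring

/-- **(stingray) ∧ (toot) ⇒ COROLLARY 1, assembled**: the whole of §3.6 from (toot) on — (toot) ⇒ Lemma 17 ⇒ (with (stingray))
Theorem 2 ⇒ Corollary 1 — kernel-checked over the cell's polymer model (d = 3 constants c₁ = 32, κ₀/K₀(32,6); 𝒪(1) of (swat) =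
e^{1/4}); hypotheses: (stingray), (toot) with κ′ − κ₀ = R + 1 ≥ r₁ + 2κ₀(32,6) + 3, r₁ ≥ κ₀(32,6), 32cλ^{β/2} ≤ 1, the KP smallness
e^{1/4}λ^{β/2}e^{5r₁+1}K₀(32,6)·32 ≤ 1, m ≤ 𝖬 and the absorbed smallness e·32·K₀(32,6)²·e^{1/4}·K₀(32,6) ≤ M³.
[cite: Dimock2013BalabanIII, §3.6 ((toot), Lemma 17, Theorem 2, Corollary 1) (arXiv:1304.0705v1 TeX L2439–2505)] -/
theorem stability_of_toot {L m Mv N : ℕ} [NeZero L] [NeZero (L ^ (Mv - m))] {lam ε₀ μ₀ : ℝ}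
    {K : TDom 3 (L ^ (Mv - m)) → ℝ} {c β R r₁ : ℝ} (hm : m ≤ Mv)
    (hrep : ComponentRepresentation L Mv N (L ^ (Mv - m)) lam ε₀ μ₀ K)
    (hK : TootBound (L ^ (Mv - m)) K c lam β R) (hc : 0 ≤ c) (hlam : 0 < lam)
    (htoot : 32 * c * lam ^ (β / 2) ≤ 1)
    (hr₁ : kappa₀ 32 6 ≤ r₁) (hrate : r₁ + 2 * kappa₀ 32 6 + 2 ≤ R)
    (hsmall : Real.exp (1 / 4) * lam ^ (β / 2) * Real.exp (5 * r₁ + 1) * K₀ 32 6 * 32 ≤ 1)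
    (hM : Real.exp 1 * 32 * K₀ 32 6 ^ 2 * Real.exp (1 / 4) * K₀ 32 6 ≤ ((L : ℝ) ^ m) ^ 3) :
    Real.exp (-(lam ^ (β / 2) * (L : ℝ) ^ (3 * Mv))) ≤ relativePartitionFunction L Mv N 1 lam ε₀ μ₀ ∧
      relativePartitionFunction L Mv N 1 lam ε₀ μ₀ ≤ Real.exp (lam ^ (β / 2) * (L : ℝ) ^ (3 * Mv)) :=
  stability_of_components hm hrep (componentActivityBound_of_toot hK hc hlam.le htoot) (Real.exp_nonneg _) hlam
    hr₁ hrate hsmall hM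

end Literature.MathematicalPhysics.QuantumFieldTheory.Dimock2011to13

end
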